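import Literature.NumberTheory.Automorphic.RealMatrixGroups
import Mathlib.Analysis.Complex.Polynomial.Basic
import Mathlib.Analysis.SpecialFunctions.Exponential
import Mathlib.Analysis.LocallyConvex.Bounded
import HarnessLib

/-!
# `U(N, A)` and `K = G ∩ U(N, A)` are compact, and `K` is a maximal compact subgroup —
proofs for `Literature.NumberTheory.Automorphic.RealMatrixGroups`

Sibling proof file of `Literature.NumberTheory.Automorphic.RealMatrixGroups` (namespace
`Literature.Automorphic`; kept separate because the proof needs the fundamental theorem of algebra,
`Mathlib.Analysis.Complex.Polynomial.Basic`, a heavy import). It proves, sorry-free: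

* `RealMatrixGroup.eq_maximalCompact_of_le_of_isCompact` : for a linear real group `G ≤ GL N A`
  over a finite-dimensional star-formally-real commutative real Banach `*`-algebra `A` *whose
  involution is `ℝ`-linear* (`[StarModule ℝ A]`) admitting the global Cartan decomposition
  `G = K · exp 𝔭`, every compact subgroup `K'` with `K ≤ K' ≤ G` equals `K = G ∩ U(N, A)`
  (Knapp, Thm. 6.31(g), Prop. 7.19(a));
* `RealMatrixGroup.isMaximalCompact_maximalCompact_holds` : the named fact
  `RealMatrixGroup.isMaximalCompact_maximalCompact` of the sibling file, discharged for every `A`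
  carrying `[StarModule ℝ A]` (see the discrepancy note below);
* on the way, Knapp's "unbounded eigenvalues" step as a standalone statement,
  `IsStarFormallyReal.eq_zero_of_isVonNBounded_of_exp_pow_mem` : a hermitian matrix `X` over such
  an `A` all of whose powers `exp(X)ⁿ`, `exp(-X)ⁿ` lie in one bounded set is `0`.
* `isCompact_unitarySubgroupGL_holds` : the named fact `isCompact_unitarySubgroupGL` of the
  sibling file — `U(N, A)` is compact for `A` finite-dimensional and star-formally real (Knapp,
  I.§17, (1.135)–(1.137): `O(n)`, `U(n)` are compact by the Heine–Borel theorem), see the section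
  "Compactness of `U(N, A)`" below; and its corollary
  `RealMatrixGroup.isCompact_maximalCompact_holds` : the named fact
  `RealMatrixGroup.isCompact_maximalCompact` (`K = G ∩ U(N, A)` is compact, `G` being closed).

## `IsStarFormallyReal` is a hypothesis, not a fact

`IsStarFormallyReal A` (`RealMatrixGroups`) is a *predicate* on the coefficient algebra `A` — the
standing hypothesis `hA` of the compactness facts above — not a closed statement, so it has no
discharge `IsStarFormallyReal_holds`; its unconditional closure `∀ A, IsStarFormallyReal A` is
false (`not_forall_isStarFormallyReal`: `ℂ` with the trivial involution, `1·1 + i·i = 0`).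
The last section, "Star-formal reality of the coefficient algebra", proves instead:

* `IsStarFormallyReal.of_starOrderedRing` : every commutative C⋆-ring carrying its star order is
  star-formally real; hence `IsStarFormallyReal.rclike`, `isStarFormallyReal_real`,
  `isStarFormallyReal_complex`;
* `IsStarFormallyReal.prod`, `IsStarFormallyReal.pi` : stability under binary and finite products,
  whence `isStarFormallyReal_piReal_prod_piComplex : IsStarFormallyReal ((ι → ℝ) × (κ → ℂ))`
  (the archimedean algebra `K_∞ ≅ ℝ^{r₁} × ℂ^{r₂}` of a number field; the `mixedSpace K` instance
  `isStarFormallyReal_mixedSpace` is in `AdelicGLnGlue`);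
* `not_isStarFormallyReal_complex_trivialStar`, `not_forall_isStarFormallyReal` : the
  counterexample.

## Discrepancy with the vendored named fact

`RealMatrixGroup.isMaximalCompact_maximalCompact` is declared in a section with
`variable [StarModule ℝ A]`, and its docstring assumes the *standard* involutions on
`A ≅ ℝ^r × ℂ^s`, but its body does not mention that instance, so the elaborated `def` quantifies
over *every* ring involution `star` on `A` (its binders are `[NormedCommRing A] [NormedAlgebra ℝ A]
[NormedAlgebra ℚ A] [CompleteSpace A] [StarRing A]` only).  Knapp's theorem is about the conjugate
transpose, whose involution (complex conjugation) is `ℝ`-linear; without `[StarModule ℝ A]` the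
statement also ranges over discontinuous involutions — e.g. `ℂ` with `σ = τ ∘ conj ∘ τ⁻¹` for a
wild field automorphism `τ` with `τ(2^{1/4}) = i·2^{1/4}`: this `σ` is star-formally real (its
fixed field `τ(ℝ)` is real closed), yet the `1 × 1` `σ`-hermitian matrix `X = (i·2^{1/4})`
(`σ X = X` as `X ∈ τ(ℝ)`) is non-zero with all `exp(n X)`, `n ∈ ℤ`, of modulus `1`, so the
eigenvalue argument below is unavailable there and that generality is not the cited result.
Following the Literature protocol (never edit a vendored fact's meaning in place) the corrected
statement — the same statement with the involution `ℝ`-linear — is proved here under the new name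
`RealMatrixGroup.eq_maximalCompact_of_le_of_isCompact`, and
`RealMatrixGroup.isMaximalCompact_maximalCompact_holds` derives the vendored fact from it for all
`A` with `[StarModule ℝ A]` (which covers `ℝ`, `ℂ`, and `K ⊗_ℚ ℝ` for a number field `K`, the
only intended coefficient algebras).  The same remark applies to the sibling fact
`RealMatrixGroup.isCompact_maximalCompact`.

## The printed proof and its formalisation

Knapp, *Lie Groups Beyond an Introduction*, Thm. 6.31(g) (statement p. 362, proof p. 366) and
Prop. 7.19(a) (p. 448): if `K ⊊ K₁` with `K₁` compact, pick `x ∈ K₁ ∖ K` and write `x = k exp X`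
(global Cartan decomposition, `X` hermitian); then `exp X ∈ K₁`, `exp X ≠ 1`, and "the powers of
`exp X` have unbounded eigenvalues" (p. 366), resp. "`(exp X)ⁿ = exp nX` has a convergent
subsequence, but this contradicts the homeomorphism `K × 𝔭 → G`" (p. 448), contradicting the
compactness of `K₁`.

Over a general coefficient algebra `A` (we only know `∑ star xᵢ * xᵢ = 0 → xᵢ = 0`) there is no
spectral theorem at hand, so "unbounded eigenvalues" is implemented by an *eigen-matrix* argument:

* `IsStarFormallyReal.eq_zero_of_star_mul_self_add` — formal reality at matrix level:
  `star Y * Y + star Z * Z = 0 → Y = 0 ∧ Z = 0` (diagonal entries are the sums `∑ᵢ star Yᵢⱼ Yᵢⱼ`).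
* hence for hermitian `H`: `H (H M) = 0 → H M = 0` (no nilpotency) and
  `((H - a)² + b²) M = 0`, `b ≠ 0` `→ M = 0` (no non-real eigenvalues; this is where
  `star (a • 1) = a • 1`, i.e. `[StarModule ℝ A]`, is used),
  `IsStarFormallyReal.mul_eq_zero_of_mul_mul_eq_zero`, `IsStarFormallyReal.eq_zero_of_quadratic`.
* `exp_mul_eq_exp_smul_of_mul_eq_smul` — `H M = c M → exp(H) M = eᶜ M` in any real Banach algebra,
  and `eq_zero_of_pow_smul_mem_of_isVonNBounded` — `μ > 1`, all `μⁿ • m` in a bounded set `→ m = 0`;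
  together: a real eigenvalue `c ≠ 0` of `H` with eigen-matrix `M` and `{exp(±H)ⁿ M}` bounded forces
  `M = 0`.
* `IsStarFormallyReal.mul_eq_zero_of_aeval_mul_eq_zero` — strong induction on the degree of a
  polynomial `f ≠ 0` with `f(H) M = 0`, peeling off a complex root (fundamental theorem of algebra):
  a non-real root gives a real quadratic factor (`Polynomial.quadratic_dvd_of_aeval_eq_zero_im_ne_zero`),
  a real root `r ≠ 0` is excluded by boundedness, `r = 0` is absorbed by "no nilpotency";
  conclusion `H M = 0`.  Applied to an annihilating polynomial of `H` (matrices are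
  finite-dimensional over `ℝ`) and `M = 1` this gives `H = 0`
  (`IsStarFormallyReal.eq_zero_of_isVonNBounded_of_exp_pow_mem`), i.e. `exp X = 1` and
  `x = k ∈ K`.

## Compactness of `U(N, A)`: the printed proof and its formalisation

Knapp, I.§17, (1.135)–(1.137), pp. 111–113, proves that `SO(n)`, `SU(n)`, `Sp(n)` and the
"related compact groups" `O(n) = {g ∈ GL(n, ℝ) | g* g = 1}`, `U(n) = {g ∈ GL(n, ℂ) | g* g = 1}`
are compact "by the Heine–Borel Theorem, their entries being bounded in absolute value by 1".
The vendored fact `isCompact_unitarySubgroupGL` is stated for a general finite-dimensional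
star-formally-real commutative real `*`-algebra `A` with `ℝ`-linear involution (e.g. `ℝ`, `ℂ`,
`ℝ^{r₁} × ℂ^{r₂}`), and `isCompact_unitarySubgroupGL_holds` runs the same Heine–Borel argument in
the finite-dimensional real normed space `Matrix N N A` (elementwise sup norm,
`Matrix.normedAddCommGroup`/`Matrix.normedSpace` as local instances), replacing the entrywise
bound by the following one: the continuous map `ψ u := star u * u` satisfies
`ψ (c • u) = (c * c) • ψ u` and, by matrix-level formal reality
(`IsStarFormallyReal.eq_zero_of_star_mul_self_add`), vanishes only at `u = 0`; hence `‖ψ ·‖` has a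
positive lower bound `δ` on the (compact) unit sphere and `star g * g = 1` forces `δ ‖g‖² ≤ ‖1‖`.
Continuity of `star : A → A` is automatic (`ℝ`-linear on a finite-dimensional space).  Finally the
compact set `unitary (Matrix N N A)` is carried onto `unitarySubgroup (GL N A)` by the continuous
monoid map `Unitary.toUnits`, whose range it is.

## References

* A. W. Knapp, *Lie Groups Beyond an Introduction*, 2nd ed., Progress in Math. 140, Birkhäuser
  2002 (= Digital 2nd ed. 2023, same pagination), I.§17, (1.135)–(1.137), pp. 111–113
  (compactness of `O(n)`, `U(n)`); Thm. 6.31(g) p. 362 with proof p. 366; Prop. 7.19(a) p. 448.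
  [cite: Knapp2002, I.§17 (1.135)–(1.137), Thm. 6.31(g) and Prop. 7.19(a)]
-/

open scoped MatrixGroups Matrix Topology

open NormedSpace -- for `exp`

noncomputable section

namespace Literature.NumberTheory.Automorphic

/-! ## Two analytic lemmas in a real Banach algebra / real topological vector space -/

section Analytic

/-- If `x * m = c • m` in a real Banach algebra then `exp x * m = eᶜ • m` (apply the exponential
series to the "eigenvector" `m`). Knapp, 0.§2 (power series of `exp`). [folklore] -/
theorem exp_mul_eq_exp_smul_of_mul_eq_smul {𝔸 : Type*} [NormedRing 𝔸] [NormedAlgebra ℝ 𝔸]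
    [CompleteSpace 𝔸] {x m : 𝔸} {c : ℝ} (h : x * m = c • m) :
    exp x * m = Real.exp c • m := by
  have hpow : ∀ n : ℕ, x ^ n * m = c ^ n • m := by
    intro n
    induction n with
    | zero => simp
    | succ n ih => rw [pow_succ, mul_assoc, h, mul_smul_comm, ih, smul_smul, ← pow_succ']
  have h1 : HasSum (fun n => ((n.factorial⁻¹ : ℝ) • x ^ n) * m) (exp x * m) :=
    (NormedSpace.exp_series_hasSum_exp' (𝕂 := ℝ) x).mul_right m
  have h2 : HasSum (fun n => ((n.factorial⁻¹ : ℝ) • x ^ n) * m) (Real.exp c • m) := by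
    have h3 : HasSum (fun n => ((n.factorial⁻¹ : ℝ) • c ^ n)) (Real.exp c) := by
      rw [Real.exp_eq_exp_ℝ]
      exact NormedSpace.exp_series_hasSum_exp' c
    convert h3.smul_const m using 1
    funext n
    rw [smul_mul_assoc, hpow, smul_smul, smul_eq_mul]
  exact h1.unique h2

/-- In a real topological vector space, if all `μⁿ • m` (`μ > 1`) lie in a (von Neumann) bounded
set then `m = 0`. This is the "unbounded eigenvalues" step of Knapp, proof of Thm. 6.31(g),
p. 366. [folklore] -/
theorem eq_zero_of_pow_smul_mem_of_isVonNBounded {E : Type*} [AddCommGroup E] [Module ℝ E]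
    [TopologicalSpace E] [T1Space E] {T : Set E} (hT : Bornology.IsVonNBounded ℝ T)
    {μ : ℝ} (hμ : 1 < μ) {m : E} (hm : ∀ n : ℕ, μ ^ n • m ∈ T) : m = 0 := by
  by_contra h0
  have hV : ({m}ᶜ : Set E) ∈ 𝓝 (0 : E) :=
    isOpen_compl_singleton.mem_nhds (by simpa using fun h => h0 h.symm)
  obtain ⟨r, hr⟩ := absorbs_iff_norm.mp (hT hV)
  obtain ⟨n, hn⟩ := pow_unbounded_of_one_lt r hμ
  have hμn : (0 : ℝ) < μ ^ n := pow_pos (zero_lt_one.trans hμ) n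
  have hsub := hr (μ ^ n) (by rw [Real.norm_of_nonneg hμn.le]; exact hn.le)
  have := hsub (hm n)
  rw [Set.smul_mem_smul_set_iff₀ hμn.ne'] at this
  exact this rfl

end Analytic

/-! ## Formal reality at matrix level -/

section FormallyReal

variable {A : Type*} [NormedCommRing A] [StarRing A] {N : Type*} [Fintype N]

/-- `IsStarFormallyReal` for families indexed by an arbitrary finite type. Knapp, I.§1. [folklore] -/
theorem IsStarFormallyReal.eq_zero_of_sum_eq_zero {ι : Type*} [Fintype ι]
    (hA : IsStarFormallyReal A) (x : ι → A) (h : ∑ i, star (x i) * x i = 0) (i : ι) : x i = 0 := by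
  classical
  set e := Fintype.equivFin ι
  have h' : ∑ j, star (x (e.symm j)) * x (e.symm j) = 0 := by
    rwa [e.symm.sum_comp (fun i => star (x i) * x i)]
  simpa [e] using hA _ (x ∘ e.symm) h' (e i)

/-- Matrix-level formal reality: `star Y * Y + star Z * Z = 0` forces `Y = 0` and `Z = 0` (read off
the diagonal entries `∑ᵢ star Yᵢⱼ Yᵢⱼ + ∑ᵢ star Zᵢⱼ Zᵢⱼ = 0`). Knapp, I.§1. [folklore] -/
theorem IsStarFormallyReal.eq_zero_of_star_mul_self_add (hA : IsStarFormallyReal A)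
    {Y Z : Matrix N N A} (h : star Y * Y + star Z * Z = 0) : Y = 0 ∧ Z = 0 := by
  have key : ∀ j, (∀ i, Y i j = 0) ∧ (∀ i, Z i j = 0) := by
    intro j
    have hj := congr_fun (congr_fun h j) j
    simp only [Matrix.add_apply, Matrix.mul_apply, Matrix.star_apply, Matrix.zero_apply] at hj
    have hx := hA.eq_zero_of_sum_eq_zero (Sum.elim (fun i => Y i j) (fun i => Z i j))
      (by simpa using hj)
    exact ⟨fun i => hx (Sum.inl i), fun i => hx (Sum.inr i)⟩
  exact ⟨Matrix.ext fun i j => (key j).1 i, Matrix.ext fun i j => (key j).2 i⟩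

/-- No nilpotency for hermitian matrices over a star-formally-real algebra:
`H (H M) = 0 → H M = 0` (`star (H M) (H M) = star M · H (H M)`). Knapp, I.§1. [folklore] -/
theorem IsStarFormallyReal.mul_eq_zero_of_mul_mul_eq_zero (hA : IsStarFormallyReal A)
    {H M : Matrix N N A} (hH : star H = H) (h : H * (H * M) = 0) : H * M = 0 := by
  refine (hA.eq_zero_of_star_mul_self_add (Y := H * M) (Z := 0) ?_).1
  rw [star_zero, zero_mul, add_zero, star_mul, hH, mul_assoc, h, mul_zero]

variable [NormedAlgebra ℝ A] [StarModule ℝ A] [DecidableEq N]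

/-- No non-real eigenvalues for hermitian matrices over a star-formally-real algebra:
`((H - a)² + b²) M = 0` with `b ≠ 0` forces `M = 0`
(`star ((H - a) M) ((H - a) M) + star (b M) (b M) = star M · ((H - a)² + b²) M`).
Knapp, I.§1. [folklore] -/
theorem IsStarFormallyReal.eq_zero_of_quadratic (hA : IsStarFormallyReal A)
    {H M : Matrix N N A} (hH : star H = H) (a b : ℝ) (hb : b ≠ 0)
    (h : ((H - algebraMap ℝ (Matrix N N A) a) ^ 2 + algebraMap ℝ (Matrix N N A) (b ^ 2)) * M = 0) :
    M = 0 := by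
  set Y := H - algebraMap ℝ (Matrix N N A) a with hYdef
  have hY : star Y = Y := by
    rw [hYdef, star_sub, hH, ← algebraMap_star_comm, star_trivial]
  have h' : Y * (Y * M) + (b ^ 2) • M = 0 := by
    rwa [add_mul, pow_two, mul_assoc, Algebra.algebraMap_eq_smul_one, smul_mul_assoc, one_mul] at h
  have key := hA.eq_zero_of_star_mul_self_add (Y := Y * M) (Z := b • M) (by
    calc star (Y * M) * (Y * M) + star (b • M) * (b • M)
        = star M * (Y * (Y * M) + (b ^ 2) • M) := by
          rw [star_mul, hY, star_smul, star_trivial b, mul_add, smul_mul_assoc, mul_smul_comm,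
            mul_smul_comm, smul_smul, pow_two, mul_assoc]
      _ = 0 := by rw [h', mul_zero])
  exact (smul_eq_zero.mp key.2).resolve_left hb

end FormallyReal

/-! ## The polynomial argument -/

section Poly

open Polynomial

variable {A : Type*} [NormedCommRing A] [StarRing A] [NormedAlgebra ℝ A] [StarModule ℝ A]
  {N : Type*} [Fintype N] [DecidableEq N]

/-- The core of "hermitian matrices with bounded `exp`-powers vanish": if `H` is hermitian over a
star-formally-real `A`, `H` has no eigen-matrix for any real eigenvalue `c ≠ 0` (hypothesis `hbd`,
supplied by boundedness), and `f ≠ 0` is a real polynomial with `f(H) M = 0`, then `H M = 0`.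
Strong induction on `deg f`, splitting off a complex root of `f` (fundamental theorem of algebra).
Knapp, proof of Thm. 6.31(g), p. 366 ("unbounded eigenvalues"). [folklore] -/
theorem IsStarFormallyReal.mul_eq_zero_of_aeval_mul_eq_zero (hA : IsStarFormallyReal A)
    {H : Matrix N N A} (hH : star H = H)
    (hbd : ∀ (M : Matrix N N A) (c : ℝ), c ≠ 0 → H * M = c • M → M = 0) :
    ∀ (f : ℝ[X]), f ≠ 0 → ∀ M : Matrix N N A, aeval H f * M = 0 → H * M = 0 := by
  suffices key : ∀ (n : ℕ) (f : ℝ[X]), f.natDegree = n → f ≠ 0 →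
      ∀ M : Matrix N N A, aeval H f * M = 0 → H * M = 0 from
    fun f hf M hM => key _ f rfl hf M hM
  intro n
  induction n using Nat.strong_induction_on with
  | _ n ih =>
    intro f hdeg hf M hM
    by_cases hn : n = 0
    · -- `f` is a non-zero constant
      subst hn
      have hfC : f = C (f.coeff 0) := eq_C_of_natDegree_eq_zero hdeg
      have hc : f.coeff 0 ≠ 0 := fun h0 => hf (by rw [hfC, h0, map_zero])
      rw [hfC, aeval_C, Algebra.algebraMap_eq_smul_one, smul_mul_assoc, one_mul] at hM
      rw [(smul_eq_zero.mp hM).resolve_left hc, mul_zero]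
    · -- `f` has a complex root `z`
      have hdeg' : f.degree ≠ 0 := (natDegree_pos_iff_degree_pos.mp (by omega)).ne'
      obtain ⟨z, hz⟩ := IsAlgClosed.exists_aeval_eq_zero ℂ f hdeg'
      by_cases him : z.im = 0
      · -- real root `r = z.re`
        have hroot : f.IsRoot z.re := by
          have hzr : z = algebraMap ℝ ℂ z.re := by
            rw [Complex.coe_algebraMap]
            exact Complex.ext (by simp) (by simp [him])
          rw [hzr, aeval_algebraMap_apply_eq_algebraMap_eval,
            map_eq_zero_iff _ (algebraMap ℝ ℂ).injective] at hz
          exact hz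
        set g := f /ₘ (X - C z.re)
        have hfg : f = (X - C z.re) * g := (mul_divByMonic_eq_iff_isRoot.mpr hroot).symm
        have hg0 : g ≠ 0 := fun h0 => hf (by rw [hfg, h0, mul_zero])
        have hgdeg : g.natDegree < n := by
          have := congrArg natDegree hfg
          rw [natDegree_mul (X_sub_C_ne_zero z.re) hg0, natDegree_X_sub_C] at this
          omega
        -- `(H - r) (g(H) M) = 0`
        have hM' : H * (aeval H g * M) = z.re • (aeval H g * M) := by
          rw [hfg, map_mul, map_sub, aeval_X, aeval_C, mul_assoc, sub_mul, sub_eq_zero,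
            Algebra.algebraMap_eq_smul_one, smul_mul_assoc, one_mul] at hM
          exact hM
        by_cases hr0 : z.re = 0
        · -- `H (g(H) M) = 0`, i.e. `g(H) (H M) = 0`, so `H (H M) = 0` by induction, so `H M = 0`
          rw [hr0, zero_smul] at hM'
          have hcomm : aeval H g * H = H * aeval H g := by
            have h1 : aeval H (g * X) = aeval H (X * g) := by rw [mul_comm]
            simpa only [map_mul, aeval_X] using h1
          have hHM : aeval H g * (H * M) = 0 := by rw [← mul_assoc, hcomm, mul_assoc, hM']
          exact hA.mul_eq_zero_of_mul_mul_eq_zero hH (ih _ hgdeg g rfl hg0 (H * M) hHM)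
        · exact ih _ hgdeg g rfl hg0 M (hbd _ z.re hr0 hM')
      · -- non-real root: `(X - re z)² + (im z)²` divides `f`
        obtain ⟨g, hfg⟩ := f.quadratic_dvd_of_aeval_eq_zero_im_ne_zero hz him
        have hq : (X ^ 2 - C (2 * z.re) * X + C (‖z‖ ^ 2) : ℝ[X]) =
            (X - C z.re) ^ 2 + C (z.im ^ 2) := by
          rw [Complex.sq_norm, Complex.normSq_apply]
          simp only [map_mul, map_add, map_pow, map_ofNat]
          ring
        have h2 : natDegree (X ^ 2 - C (2 * z.re) * X + C (‖z‖ ^ 2) : ℝ[X]) = 2 := by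
          compute_degree!
        have hq0 : (X ^ 2 - C (2 * z.re) * X + C (‖z‖ ^ 2) : ℝ[X]) ≠ 0 :=
          ne_zero_of_natDegree_gt (n := 1) (by rw [h2]; exact one_lt_two)
        have hg0 : g ≠ 0 := fun h0 => hf (by rw [hfg, h0, mul_zero])
        have hgdeg : g.natDegree < n := by
          have := congrArg natDegree hfg
          rw [natDegree_mul hq0 hg0, h2] at this
          omega
        have hM' : aeval H g * M = 0 := by
          rw [hfg, hq, map_mul, mul_assoc, map_add, map_pow, map_sub, aeval_X, aeval_C,
            aeval_C] at hM
          exact hA.eq_zero_of_quadratic hH z.re z.im him hM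
        exact ih _ hgdeg g rfl hg0 M hM'

/-- A hermitian matrix over a finite-dimensional star-formally-real algebra without non-zero real
eigen-matrices is zero: apply `mul_eq_zero_of_aeval_mul_eq_zero` to an annihilating polynomial
of `H` and `M = 1`. Knapp, proof of Thm. 6.31(g), p. 366. [folklore] -/
theorem IsStarFormallyReal.eq_zero_of_forall_mul_eq_smul [FiniteDimensional ℝ A]
    (hA : IsStarFormallyReal A) {H : Matrix N N A} (hH : star H = H)
    (hbd : ∀ (M : Matrix N N A) (c : ℝ), c ≠ 0 → H * M = c • M → M = 0) : H = 0 := by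
  obtain ⟨f, hfm, hf⟩ := Algebra.IsIntegral.isIntegral (R := ℝ) H
  rw [← aeval_def] at hf
  have := hA.mul_eq_zero_of_aeval_mul_eq_zero hH hbd f hfm.ne_zero 1 (by rw [hf, zero_mul])
  rwa [mul_one] at this

end Poly

/-! ## Bounded `exp`-powers of a hermitian matrix -/

section ExpPowers

variable {A : Type*} [NormedCommRing A] {N : Type*} [Fintype N] [DecidableEq N]
  [NormedAlgebra ℝ A] [CompleteSpace A]

-- As in `Mathlib/Analysis/Normed/Algebra/MatrixExponential.lean`: the scoped `L∞`-operator normed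
-- ring structure on matrices is only reducibly-defeq to the Pi uniformity, so finding
-- `CompleteSpace (Matrix N N A)` for the Banach-algebra lemma needs this unifier setting.
set_option backward.isDefEq.respectTransparency false in
/-- Powers of `exp X` act on an eigen-matrix by powers of the exponential of the eigenvalue:
`X M = c M → (exp X)ⁿ M = (eᶜ)ⁿ M`. Knapp, 0.§2. [folklore] -/
theorem exp_pow_mul_eq_of_mul_eq_smul {X M : Matrix N N A} {c : ℝ} (h : X * M = c • M) (n : ℕ) :
    exp X ^ n * M = Real.exp c ^ n • M := by
  have h1 : exp X * M = Real.exp c • M :=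
    open scoped Matrix.Norms.Operator in exp_mul_eq_exp_smul_of_mul_eq_smul h
  induction n with
  | zero => simp
  | succ n ih => rw [pow_succ, mul_assoc, h1, mul_smul_comm, ih, smul_smul, ← pow_succ']

variable [StarRing A] [StarModule ℝ A]

/-- **Knapp's "unbounded eigenvalues" step** (proof of Thm. 6.31(g), p. 366): over a
finite-dimensional star-formally-real `A` with `ℝ`-linear involution, a hermitian matrix `X` all
of whose powers `exp(X)ⁿ` and `exp(-X)ⁿ` (`n ∈ ℕ`) lie in one bounded set of matrices is `0`.
Indeed an eigen-matrix `M` of `X` for a real eigenvalue `c ≠ 0` satisfies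
`exp(±X)ⁿ M = e^{±nc} M`, unbounded unless `M = 0`; so `X` has no such eigen-matrix and the
polynomial argument `IsStarFormallyReal.eq_zero_of_forall_mul_eq_smul` gives `X = 0`.
Knapp, *Lie Groups Beyond an Introduction*, proof of Thm. 6.31(g), p. 366. [folklore] -/
theorem IsStarFormallyReal.eq_zero_of_isVonNBounded_of_exp_pow_mem [FiniteDimensional ℝ A]
    (hA : IsStarFormallyReal A) {X : Matrix N N A} (hX : star X = X) {S : Set (Matrix N N A)}
    (hS : Bornology.IsVonNBounded ℝ S) (h₁ : ∀ n : ℕ, exp X ^ n ∈ S)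
    (h₂ : ∀ n : ℕ, exp (-X) ^ n ∈ S) : X = 0 := by
  refine hA.eq_zero_of_forall_mul_eq_smul hX fun M c hc hXM => ?_
  -- right multiplication by `M` is continuous linear, so `{s * M | s ∈ S}` is bounded too
  set T : Set (Matrix N N A) := (fun s => s * M) '' S
  have hT : Bornology.IsVonNBounded ℝ T :=
    hS.image (⟨LinearMap.mulRight ℝ M, continuous_id.mul continuous_const⟩ :
      Matrix N N A →L[ℝ] Matrix N N A)
  have hmem₁ : ∀ n : ℕ, Real.exp c ^ n • M ∈ T := fun n =>
    ⟨exp X ^ n, h₁ n, exp_pow_mul_eq_of_mul_eq_smul hXM n⟩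
  have hmem₂ : ∀ n : ℕ, Real.exp (-c) ^ n • M ∈ T := fun n =>
    ⟨exp (-X) ^ n, h₂ n, exp_pow_mul_eq_of_mul_eq_smul (by rw [neg_mul, hXM, neg_smul]) n⟩
  rcases lt_or_gt_of_ne hc with hc | hc
  · exact eq_zero_of_pow_smul_mem_of_isVonNBounded hT
      (Real.one_lt_exp_iff.mpr (neg_pos.mpr hc)) hmem₂
  · exact eq_zero_of_pow_smul_mem_of_isVonNBounded hT (Real.one_lt_exp_iff.mpr hc) hmem₁

end ExpPowers

/-! ## Maximality of `K` -/

namespace RealMatrixGroup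

variable {A : Type*} [NormedCommRing A] {N : Type*} [Fintype N] [DecidableEq N]
  [NormedAlgebra ℝ A] [NormedAlgebra ℚ A] [CompleteSpace A] [StarRing A] (G : RealMatrixGroup A N)

/-- **`K = G ∩ U(N, A)` is a maximal compact subgroup** (corrected form of the named fact
`RealMatrixGroup.isMaximalCompact_maximalCompact`, with the involution of `A` `ℝ`-linear as for
Knapp's conjugate transpose — see the module docstring for the discrepancy): for a linear real
group `G ≤ GL N A` over a finite-dimensional star-formally-real `A` with `[StarModule ℝ A]`
admitting the global Cartan decomposition `G = K · exp 𝔭`, every compact subgroup `K'` with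
`K ≤ K' ≤ G` equals `K`.  Proof as printed: `g = k · exp X ∈ K'` (`k ∈ K ⊆ K'`, `X` hermitian)
gives `exp X ∈ K'`, so all `exp(±X)ⁿ` lie in the compact, hence bounded, set `K'`, whence `X = 0`
by `IsStarFormallyReal.eq_zero_of_isVonNBounded_of_exp_pow_mem` and `g = k ∈ K`.
Knapp, *Lie Groups Beyond an Introduction*, Thm. 6.31(g) (p. 362, proof p. 366) and
Prop. 7.19(a) (p. 448). [cite: Knapp2002, Thm. 6.31(g) and Prop. 7.19(a)] -/
theorem eq_maximalCompact_of_le_of_isCompact [FiniteDimensional ℝ A] [StarModule ℝ A]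
    (hA : IsStarFormallyReal A) (hG : G.HasCartanDecomposition) {K' : Subgroup (GL N A)}
    (hK'G : K' ≤ G.carrier) (hKK' : G.maximalCompact ≤ K') (hK' : IsCompact (K' : Set (GL N A))) :
    K' = G.maximalCompact := by
  refine le_antisymm (fun g hg => ?_) hKK'
  obtain ⟨k, hk, X, -, hXsa, rfl⟩ := hG _ (hK'G hg)
  have hP : expGL X ∈ K' := by
    have := K'.mul_mem (K'.inv_mem (hKK' hk)) hg
    rwa [inv_mul_cancel_left] at this
  -- the (compact, hence bounded) set of matrices underlying `K'` contains all `exp(±X)ⁿ`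
  have hS : Bornology.IsVonNBounded ℝ (((↑) : GL N A → Matrix N N A) '' (K' : Set (GL N A))) :=
    (hK'.image Units.continuous_val).isVonNBounded ℝ
  have hX0 : X = 0 :=
    hA.eq_zero_of_isVonNBounded_of_exp_pow_mem hXsa.star_eq hS
      (fun n => ⟨expGL X ^ n, K'.pow_mem hP n, by simp⟩)
      (fun n => ⟨(expGL X)⁻¹ ^ n, K'.pow_mem (K'.inv_mem hP) n, by simp [← expGL_neg]⟩)
  subst hX0
  rw [expGL_zero, mul_one]
  exact hk

/-- **Discharge of the named fact `RealMatrixGroup.isMaximalCompact_maximalCompact`** for every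
coefficient algebra whose involution is `ℝ`-linear (`[StarModule ℝ A]`: `ℝ`, `ℂ`, `K ⊗_ℚ ℝ`, and
the standing convention of Knapp's conjugate transpose).  The vendored `def` itself omits this
instance (an unused section variable is not part of a definition's signature) and thereby also
speaks about discontinuous involutions, a generality the source does not claim; see the module
docstring and `eq_maximalCompact_of_le_of_isCompact` for the corrected statement.
Knapp, *Lie Groups Beyond an Introduction*, Thm. 6.31(g) and Prop. 7.19(a).
[cite: Knapp2002, Thm. 6.31(g) and Prop. 7.19(a)] -/
theorem isMaximalCompact_maximalCompact_holds [StarModule ℝ A] :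
    G.isMaximalCompact_maximalCompact :=
  fun hA hG _ hK'G hKK' hK' => G.eq_maximalCompact_of_le_of_isCompact hA hG hK'G hKK' hK'

end RealMatrixGroup

/-! ## Compactness of `U(N, A)` and of `K = G ∩ U(N, A)` (Knapp, I.§17) -/

section CompactUnitary

variable {A : Type*} [NormedCommRing A] [StarRing A] {N : Type*} [Fintype N] [DecidableEq N]

/-- **Discharge of `isCompact_unitarySubgroupGL`.** `U(N, A) = {g ∈ GL N A | star g * g = 1}` is
compact for `A` a finite-dimensional star-formally-real commutative real `*`-algebra with
`ℝ`-linear involution (e.g. `ℝ`, `ℂ`, `ℝ^{r₁} × ℂ^{r₂}`), by the Heine–Borel theorem in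
`Matrix N N A`: it is closed, and bounded because `star g * g = 1` bounds `‖g‖` (see the module
docstring).  For `A = ℝ, ℂ` this is the compactness of `O(n)` and `U(n)`.
Knapp, *Lie Groups Beyond an Introduction*, I.§17, (1.135)–(1.137), pp. 111–113.
[cite: Knapp2002, I.§17, (1.135)–(1.137), pp. 111–113 (compactness of SO(n), SU(n), Sp(n), O(n),
U(n) by Heine–Borel)] -/
theorem isCompact_unitarySubgroupGL_holds : isCompact_unitarySubgroupGL (A := A) (N := N) := by
  intro _ _ _ hA
  -- `star : A → A` is `ℝ`-linear, hence continuous, `A` being finite-dimensional.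
  haveI : ContinuousStar A := by
    refine ⟨?_⟩
    let f : A →ₗ[ℝ] A :=
      { toFun := star
        map_add' := star_add
        map_smul' := fun r a => by simp only [star_smul, star_trivial, RingHom.id_apply] }
    exact f.continuous_of_finiteDimensional
  -- Step 1 (Heine–Borel): the unitary matrices form a compact subset of `Matrix N N A`.
  have hU : IsCompact (unitary (Matrix N N A) : Set (Matrix N N A)) := by
    letI : NormedAddCommGroup (Matrix N N A) := Matrix.normedAddCommGroup
    letI : NormedSpace ℝ (Matrix N N A) := Matrix.normedSpace
    -- the map `ψ u = star u * u`: continuous, vanishing only at `0`, quadratic under real scaling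
    set ψ : Matrix N N A → Matrix N N A := fun u => star u * u with hψ_def
    have hψc : Continuous ψ := continuous_star.mul continuous_id
    have hψ0 : ∀ u, ψ u = 0 → u = 0 := fun u hu =>
      (hA.eq_zero_of_star_mul_self_add (Y := u) (Z := 0)
        (by rw [star_zero, mul_zero, add_zero]; exact hu)).1
    have hψs : ∀ (c : ℝ) (u : Matrix N N A), ψ (c • u) = (c * c) • ψ u := by
      intro c u
      simp only [ψ, star_smul, star_trivial, smul_mul_smul_comm]
    -- a positive lower bound for `‖ψ ·‖` on the (compact, possibly empty) unit sphere
    obtain ⟨δ, hδ0, hδ⟩ :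
        ∃ δ : ℝ, 0 < δ ∧ ∀ v ∈ Metric.sphere (0 : Matrix N N A) 1, δ ≤ ‖ψ v‖ :=
      (isCompact_sphere (0 : Matrix N N A) 1).exists_forall_le'
        (continuous_norm.comp hψc).continuousOn fun v hv => norm_pos_iff.mpr fun h0 => by
          have := hψ0 v h0
          simp [this] at hv
    -- closed
    have hclosed : IsClosed (unitary (Matrix N N A) : Set (Matrix N N A)) := by
      have : (unitary (Matrix N N A) : Set (Matrix N N A)) =
          {u | star u * u = 1} ∩ {u | u * star u = 1} := Set.ext fun _ => Iff.rfl
      rw [this]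
      exact (isClosed_eq hψc continuous_const).inter
        (isClosed_eq (continuous_id.mul continuous_star) continuous_const)
    -- bounded: `star u * u = 1` gives `δ ‖u‖² ≤ ‖1‖`
    have hbdd : Bornology.IsBounded (unitary (Matrix N N A) : Set (Matrix N N A)) := by
      rw [isBounded_iff_forall_norm_le]
      refine ⟨Real.sqrt (‖(1 : Matrix N N A)‖ / δ), fun u hu => ?_⟩
      have hu1 : ψ u = 1 := hu.1
      rcases eq_or_ne u 0 with rfl | hne
      · rw [norm_zero]; exact Real.sqrt_nonneg _
      have hc : 0 < ‖u‖ := norm_pos_iff.mpr hne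
      have hv : ‖u‖⁻¹ • u ∈ Metric.sphere (0 : Matrix N N A) 1 := by
        rw [mem_sphere_zero_iff_norm, norm_smul, norm_inv, norm_norm, inv_mul_cancel₀ hc.ne']
      have key : δ * (‖u‖ * ‖u‖) ≤ ‖(1 : Matrix N N A)‖ := by
        have hu' : u = ‖u‖ • (‖u‖⁻¹ • u) := (smul_inv_smul₀ hc.ne' u).symm
        calc δ * (‖u‖ * ‖u‖) ≤ ‖ψ (‖u‖⁻¹ • u)‖ * (‖u‖ * ‖u‖) := by
              gcongr
              exact hδ _ hv
          _ = ‖ψ u‖ := by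
              conv_rhs => rw [hu', hψs]
              rw [norm_smul, Real.norm_of_nonneg (mul_self_nonneg ‖u‖), mul_comm]
          _ = ‖(1 : Matrix N N A)‖ := by rw [hu1]
      calc ‖u‖ = Real.sqrt (‖u‖ * ‖u‖) := (Real.sqrt_mul_self hc.le).symm
        _ ≤ Real.sqrt (‖(1 : Matrix N N A)‖ / δ) :=
          Real.sqrt_le_sqrt ((le_div_iff₀' hδ0).mpr key)
    exact Metric.isCompact_of_isClosed_isBounded hclosed hbdd
  -- Step 2: transport along the continuous map `Unitary.toUnits : unitary (Matrix N N A) → GL N A`,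
  -- whose range is `unitarySubgroup (GL N A)`.
  haveI : CompactSpace (unitary (Matrix N N A)) := isCompact_iff_compactSpace.mp hU
  have hcont : Continuous (Unitary.toUnits : unitary (Matrix N N A) → GL N A) := by
    refine Units.continuous_iff.mpr ⟨?_, ?_⟩
    · simpa only [Function.comp_def, Unitary.val_toUnits_apply] using continuous_subtype_val
    · have : (fun x : unitary (Matrix N N A) => ((Unitary.toUnits x)⁻¹ : GL N A).val) =
          fun x : unitary (Matrix N N A) => star (x : Matrix N N A) := by
        funext x
        rw [Unitary.val_inv_toUnits_apply, ← Unitary.star_eq_inv, Unitary.coe_star]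
      rw [this]
      exact continuous_subtype_val.star
  have hrange : Set.range (Unitary.toUnits : unitary (Matrix N N A) → GL N A) =
      (unitarySubgroupGL A N : Set (GL N A)) := by
    ext g
    constructor
    · rintro ⟨u, rfl⟩
      rw [SetLike.mem_coe, mem_unitarySubgroupGL_iff_coe_mem_unitaryGroup,
        Unitary.val_toUnits_apply]
      exact u.2
    · intro hg
      exact ⟨⟨(g : Matrix N N A), (mem_unitarySubgroupGL_iff_coe_mem_unitaryGroup g).mp hg⟩,
        Units.ext rfl⟩
  rw [← hrange]
  exact isCompact_range hcont

end CompactUnitary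

namespace RealMatrixGroup

variable {A : Type*} [NormedCommRing A] {N : Type*} [Fintype N] [DecidableEq N]
  [NormedAlgebra ℝ A] [NormedAlgebra ℚ A] [CompleteSpace A] [StarRing A] [StarModule ℝ A]
  (G : RealMatrixGroup A N)

/-- **Discharge of the named fact `RealMatrixGroup.isCompact_maximalCompact`.**
`K = G ∩ U(N, A)` is compact for `A` a finite-dimensional star-formally-real commutative real
`*`-algebra with `ℝ`-linear involution: `G` is closed in `GL N A`
(`RealMatrixGroup.isCompact_maximalCompact_of_isCompact`) and `U(N, A)` is compact
(`isCompact_unitarySubgroupGL_holds`); for `G = GL n ℝ`, `GL n ℂ` this is the compactness of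
`O(n)`, `U(n)`.  Knapp, *Lie Groups Beyond an Introduction*, I.§17, (1.135)–(1.137).
[cite: Knapp2002, I.§17, (1.135)–(1.137), pp. 111–113 (compactness of O(n), U(n))] -/
theorem isCompact_maximalCompact_holds : G.isCompact_maximalCompact :=
  fun hA => G.isCompact_maximalCompact_of_isCompact (isCompact_unitarySubgroupGL_holds hA)

end RealMatrixGroup

/-! ## Star-formal reality of the coefficient algebra: criterion, instances, counterexample

`IsStarFormallyReal A` (sibling file `RealMatrixGroups`) is a *predicate* on the coefficient
`*`-algebra `A` — it is the hypothesis `hA` of `isCompact_unitarySubgroupGL`,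
`RealMatrixGroup.isCompact_maximalCompact` and `RealMatrixGroup.isMaximalCompact_maximalCompact` —
and not a closed statement: a "discharge"
`IsStarFormallyReal_holds : IsStarFormallyReal` does not typecheck, and the unconditional closure
`∀ A, IsStarFormallyReal A` is false (`not_forall_isStarFormallyReal`, witnessed by `ℂ` with the
trivial involution `starRingOfComm`, where `1 · 1 + i · i = 0`).  What is true, and proved in this
section, is that the predicate holds for the intended coefficient algebras: every commutative
C⋆-ring whose order is the star order (`IsStarFormallyReal.of_starOrderedRing`: a sum of the
non-negative elements `star xᵢ * xᵢ` vanishes only if each does, and `‖star x * x‖ = ‖x‖²`), in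
particular `ℝ`, `ℂ` and every `RCLike` field, and binary and finite products of star-formally-real
algebras (`IsStarFormallyReal.prod`, `IsStarFormallyReal.pi`, read off componentwise), whence
`ℝ^{r₁} × ℂ^{r₂}` (`isStarFormallyReal_piReal_prod_piComplex`; the number-field instance
`isStarFormallyReal_mixedSpace` lives in `AdelicGLnGlue`).  Knapp, *Lie Groups Beyond an
Introduction*, I.§1 (the conjugate transpose on `GL(n, ℝ)`, `GL(n, ℂ)`) and I.§17,
(1.135)–(1.137) (the entries of `O(n)`, `U(n)` are bounded because `∑ᵢ |gᵢⱼ|² = 1`). [folklore] -/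

section StarFormallyReal

variable {A : Type*} [NormedCommRing A] [StarRing A]

/-- Unfolding lemma for `IsStarFormallyReal`: `∑ᵢ star xᵢ * xᵢ = 0` forces all `xᵢ = 0`, for
every finite family `x : Fin n → A`. Knapp, I.§1. [folklore] -/
theorem isStarFormallyReal_iff :
    IsStarFormallyReal A ↔
      ∀ (n : ℕ) (x : Fin n → A), ∑ i, star (x i) * x i = 0 → ∀ i, x i = 0 :=
  Iff.rfl

/-- The case `n = 1` of star-formal reality: `star x * x = 0 ↔ x = 0`. Knapp, I.§1. [folklore] -/
theorem IsStarFormallyReal.star_mul_self_eq_zero_iff (hA : IsStarFormallyReal A) {x : A} :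
    star x * x = 0 ↔ x = 0 := by
  refine ⟨fun h => hA 1 (fun _ => x) (by simpa using h) 0, fun h => ?_⟩
  rw [h, mul_zero]

variable (A) in
/-- **Criterion.** A commutative C⋆-ring `A` whose partial order is the star order
(`[StarOrderedRing A]`: `a ≤ b` iff `b - a` is a sum of elements `star s * s`) is star-formally
real: in `∑ᵢ star xᵢ * xᵢ = 0` every summand is `≥ 0` (`star_mul_self_nonneg`), so each summand
vanishes (`Finset.sum_eq_zero_iff_of_nonneg`), and `‖star x * x‖ = ‖x‖ ‖x‖` (`CStarRing`) gives
`x = 0`.  Applies to `ℝ`, to `ℂ` (star order scoped in `ComplexOrder`), and to products and pi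
types of such.  Knapp, I.§1 and I.§17, (1.135)–(1.137). [folklore] -/
theorem IsStarFormallyReal.of_starOrderedRing [CStarRing A] [PartialOrder A] [StarOrderedRing A] :
    IsStarFormallyReal A := by
  intro n x hx i
  have hi : star (x i) * x i = 0 :=
    (Finset.sum_eq_zero_iff_of_nonneg fun j _ => star_mul_self_nonneg (x j)).mp hx i
      (Finset.mem_univ i)
  have h2 : ‖x i‖ * ‖x i‖ = 0 := by rw [← CStarRing.norm_star_mul_self, hi, norm_zero]
  exact norm_eq_zero.mp (mul_self_eq_zero.mp h2)

/-- Star-formal reality is stable under binary products (`star` and the sum are computed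
componentwise). Knapp, I.§1. [folklore] -/
theorem IsStarFormallyReal.prod {B : Type*} [NormedCommRing B] [StarRing B]
    (hA : IsStarFormallyReal A) (hB : IsStarFormallyReal B) : IsStarFormallyReal (A × B) := by
  intro n x hx i
  have h1 : ∑ j, star (x j).1 * (x j).1 = 0 := by
    simpa [Prod.fst_sum] using congrArg Prod.fst hx
  have h2 : ∑ j, star (x j).2 * (x j).2 = 0 := by
    simpa [Prod.snd_sum] using congrArg Prod.snd hx
  exact Prod.ext (hA n _ h1 i) (hB n _ h2 i)

/-- Star-formal reality is stable under finite products (`star` and the sum are computed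
componentwise). Knapp, I.§1. [folklore] -/
theorem IsStarFormallyReal.pi {ι : Type*} [Fintype ι] {B : ι → Type*}
    [∀ k, NormedCommRing (B k)] [∀ k, StarRing (B k)] (hB : ∀ k, IsStarFormallyReal (B k)) :
    IsStarFormallyReal (∀ k, B k) := by
  intro n x hx i
  funext k
  have hk : ∑ j, star (x j k) * x j k = 0 := by
    simpa [Finset.sum_apply] using congrFun hx k
  exact hB k n _ hk i

/-- Every `RCLike` field (`ℝ`, `ℂ` with complex conjugation) is star-formally real:
`∑ᵢ |xᵢ|² = 0` forces `xᵢ = 0`.  (`IsStarFormallyReal.of_starOrderedRing` for the star order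
`RCLike.toStarOrderedRing`, scoped in `ComplexOrder`.)  Knapp, I.§1 and I.§17, (1.135)–(1.137).
[folklore] -/
theorem IsStarFormallyReal.rclike (𝕜 : Type*) [RCLike 𝕜] : IsStarFormallyReal 𝕜 := by
  letI : PartialOrder 𝕜 := RCLike.toPartialOrder
  letI : StarOrderedRing 𝕜 := RCLike.toStarOrderedRing
  exact IsStarFormallyReal.of_starOrderedRing 𝕜

/-- `ℝ` (trivial involution) is star-formally real: `∑ᵢ xᵢ² = 0 → xᵢ = 0`. This is what bounds the
entries of `O(n)`. Knapp, I.§17, (1.135)–(1.137). [folklore] -/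
theorem isStarFormallyReal_real : IsStarFormallyReal ℝ :=
  IsStarFormallyReal.rclike ℝ

/-- `ℂ` with complex conjugation is star-formally real: `∑ᵢ |zᵢ|² = 0 → zᵢ = 0`. This is what
bounds the entries of `U(n)`. Knapp, I.§17, (1.135)–(1.137). [folklore] -/
theorem isStarFormallyReal_complex : IsStarFormallyReal ℂ :=
  IsStarFormallyReal.rclike ℂ

/-- The archimedean coefficient algebra `ℝ^ι × ℂ^κ` with the standard involutions (for a number
field `K`: `K_∞ = K ⊗_ℚ ℝ ≅ ℝ^{r₁} × ℂ^{r₂}`, Mathlib's `mixedSpace K`; cf.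
`isStarFormallyReal_mixedSpace` in `AdelicGLnGlue`) is star-formally real. Knapp, I.§1;
Borel–Jacquet, §1.1. [folklore] -/
theorem isStarFormallyReal_piReal_prod_piComplex (ι κ : Type*) [Fintype ι] [Fintype κ] :
    IsStarFormallyReal ((ι → ℝ) × (κ → ℂ)) :=
  (IsStarFormallyReal.pi fun _ => isStarFormallyReal_real).prod
    (IsStarFormallyReal.pi fun _ => isStarFormallyReal_complex)

/-- **Counterexample.** `ℂ` with the *trivial* involution (`starRingOfComm`, `star z = z`) is not
star-formally real: `1 · 1 + i · i = 0` with `1 ≠ 0`.  (For this involution `U(2)` is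
`O(2, ℂ) ∋ ((cosh t, i sinh t), (-i sinh t, cosh t))`, which is not compact — the reason why
`IsStarFormallyReal A` is a hypothesis of `isCompact_unitarySubgroupGL`.)  Knapp, I.§1.
[folklore] -/
theorem not_isStarFormallyReal_complex_trivialStar :
    ¬ @IsStarFormallyReal ℂ _ starRingOfComm := by
  letI : StarRing ℂ := starRingOfComm
  intro h
  have hx : ∑ i, star (![1, Complex.I] i) * ![1, Complex.I] i = 0 := by
    simp [Fin.sum_univ_two, star_id_of_comm]
  simpa using h 2 ![1, Complex.I] hx 0

/-- **`IsStarFormallyReal` is a hypothesis, not a fact.** The unconditional closure of the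
predicate — what a discharge `IsStarFormallyReal_holds` would have to assert — is false: not
every normed commutative `*`-ring is star-formally real
(`not_isStarFormallyReal_complex_trivialStar`). Knapp, I.§1. [folklore] -/
theorem not_forall_isStarFormallyReal :
    ¬ ∀ (B : Type) [NormedCommRing B] [StarRing B], IsStarFormallyReal B :=
  fun h => not_isStarFormallyReal_complex_trivialStar (@h ℂ _ starRingOfComm)

end StarFormallyReal

end Literature.NumberTheory.Automorphic
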